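import Summits.QuantumFields.BalabanUV.T4Continuum.Support.NE9HoloFamilyVacuumSubtracted
import Summits.QuantumFields.BalabanUV.T4Continuum.Support.NE9FutureProfileEndOfRecordSP
import Literature.MathematicalPhysics.QuantumFieldTheory.Balaban1983to89.T4HistoryLipschitzWitness

/-!
# NE9HoloFamilyPotentialKPG — route R4's TABLE HALF RUNS ON THE STADIUM ROUTE's PENCIL LETTERS: `PotentialKPG` (KP for `m`,
# not `2m`) on the ball `‖Q‖ < R₀`, with NO inner radius — the ♯-END of record at `Ψ := ΨOf` with room `ω̂·R₀ + τ̄·(2B + p̄₀) ≤ θ·R₀`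

Cell `pub-balaban`, T4-DAG §6 NE9; BINDER row NE9 OWNER lineage `b2b-balaban-t4-ne9-p1` gen 61, CRUX PROVER NE9 (ruling e34b3e0c (2));
route R4 ∕ R4♯ of `t4/ROUTES-NE9.md` v7 (rank 1).  THE OWNER's ANSWER IN KERNEL TO THE REFUTER's **Q-v9-1 ∕ T18** (PRICING-NE9 v9.0.1
§B (B9-4) ∕ §H: «can R3′ run on KP(m) alone — then its instance list KP(m) ⊊ R4's KP(2m)»).  READING [analysis of the kernel, not
of print]: R4's record-shape ENDs (D6 p255851, E130 p257304, E131 p257826) carry KP for `2m` (`hkp2`) ONLY because they were written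
in the pencil letters of `NE9TwoPointKPOfPencil` (p248329); route R4 itself never uses the doubling — (c-holo) needs the
Kotecký–Preiss condition for the ACTIVITIES with weight `a` (`differentiableOn_truncatedWeight_param_of_kp` takes `IsKPVolume inc w a`;
the tree's `NE9HoloFamilyOfPencil.isKPVolume_of_majorant` discards both the factor 2 and the weight `d` of `hkp2`), and (c-size) is
the one-point Kotecký–Preiss bound `norm_clusterSum_le_of_kp` under KP for `m` (the tree's `T4HistoryLipschitzWitness.norm_newTerm_le_of_potentialKPG`)
— BOTH on the OPEN ball `‖Q‖ < R₀`, so NO inner radius `s₀` is needed either.  Hence THIS FILE: route R4♯'s END of record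
on the record's new-term shape from `PotentialKPG W act m a d R₀` (= the letters of the R3′ ENDs p256040 ∕ p256132 ∕ p256991:
line-holomorphy + majorant on `‖Q‖ < R₀` + KP for `m`, at every background incl. `U₀`) + `hdec` + `hpin` (budget `B`) + `hΨv` +
`hexplZ`∕`hp₀` + structural binders + `hlast` (displayed here; derived from the coupling two-point letters in E131, whose engine
`norm_newTerm_sub_le_of_couplingTwoPoint` keeps KP(2n) inside `TwoPointKP` on BOTH routes) + the ROOM `ω̂·R₀ + τ̄·(2B + p̄₀) ≤ θ·R₀`.
CONSEQUENCE FOR THE PRICING (the owner's answer to Q-v9-1): the TABLE halves of both co-leads read the SAME pencil letter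
`PotentialKPG` (KP(m)); R4 needs NO occupation ∕ size-induction binder (E131 F-g61-1) and NO inner radius; R3′ needs the size-induction
block (`hbase`∕`hNsucc`∕`hNnn`∕`hbox`) + `h𝒜` + `hρ` + `s₀ < R₀`; the coupling half is the same `TwoPointKP`∕`hCup`∕`hTcup` data on
both — so T18 cannot fire in R3′'s favour: on instance economy R4 ⊊ R3′, not the converse.

HONEST FRAMING (T4-DAG PAGE 1).  Rung (B)+1 of the FINITE-VOLUME T⁴ programme — NOT infinite volume, NOT a mass gap, NOT Clay.  NE9
(`T4OutputRate.NE9` ∧ `FadingMemory`) is a cell NEW ESTIMATE, NOT PRINTED in [I] = [Balaban1987RG1] (CMP **109**), [II] =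
[Balaban1988RG2Cluster] (CMP **116**), NOT PROVED for Bałaban's E^{(j)}: every theorem below is «NE9 ⇐ the named binders»; displayed
Bałaban-side inputs: `PotentialKPG` on `R₀` at every background incl. `U₀` (= (R-0)[scope] «[II] Lemma 3 (2.38) read over Lemma 2's
box», TYPE (2.14)∕(2.15) p. 15, (2.38) p. 20), `hdec`, `hpin`, `hexplZ` (TYPE [I] (2.14) p. 268 ∕ [II] (2.41) p. 21), `hlast` (the
coupling half), structural binders, ROOM; W1 = model O-NE9-1 untouched; spine 0∕9.  HONEST DEPENDENCY (cell line, verbatim): continuum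
YM on T⁴ ⇐ BetaPertH ∧ nine spine estimates (0/9 proved); BetaPertH ⇐ (D1) ∧ (D4) ∧ CAP+tail; G-an2-4 gates asym, D1 and NE2/3/4.
`FlowStep.BetaPertH`, (B), (B^μ) do not occur; [I]∕[II] for TYPES only (ABSOLUTE RULE).  0 def, 0 sorry.  A shorter binder list
inside a CONDITIONAL END is not progress on the estimate itself.
CONTENT ([folklore]): §1 `isKPVolume_of_majorant_kp1` (majorant + KP for `m` with weights `a + d`, `d ≥ 0` ⇒ `IsKPVolume w a` on every
sub-family); §2 **`differentiableOn_newTerm_of_kp1`** ((c-holo) under KP(m)); (c-size) on the open ball = the tree's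
`T4HistoryLipschitzWitness.norm_newTerm_le_of_potentialKPG`, imported; §4 `vacSlice_clauses_of_potentialKPG` ((Φ-holo)∕(Φ-size)∕(Φ-real) of `holoSlice κ σ (newTerm_U − newTerm_{U₀} + explZ)`
on `ball 0 R₀`, budget `2B + p̄₀`); §5 **`ne9_and_fadingMemory_of_potentialKPG_SP_vac`** (star form; room on `R₀`); §6
`termSize_of_potentialKPG_room` (by-product: `TermSize E W κ (fun _ => 2B + p̄₀)` from the same data, no size induction); §7
**`ne9_and_fadingMemory_of_potentialKPG_psiOf_SP`** (at `Ψ := NE9EndApplied.ΨOf`, `rfl`).  DISGUISE TEST: composition by name over generic kernels;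
nothing of Bałaban's asserted.  References (TYPES only): [Balaban1987RG1] CMP **109** (2.13)–(2.14) p. 268, (0.23) p. 256;
[Balaban1988RG2Cluster] CMP **116** (2.13)–(2.15) pp. 14–15, (2.38) p. 20, (2.40)–(2.41) p. 21, (1.36) p. 9; [KoteckyPreiss1986] Theorem
p. 492; [FV1980] ch. V §5.  Summits-side NEW work (LEAN PLACEMENT RULE); imports D6 and leaf-05's p256694 BY NAME; modifies nothing.
Value = the doubling `2m` and the inner radius `s₀` shown IDLE on route R4's table half, NOT summit progress.
-/

noncomputable section

namespace Summit.QuantumFields.BalabanUV.T4Continuum.NE9HoloFamilyPotentialKPG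

open Metric Set ComplexConjugate
open scoped BigOperators ENNReal
open Literature.Probability.LatticeModels
open Literature.MathematicalPhysics.QuantumFieldTheory.Balaban1983to89
open Literature.MathematicalPhysics.QuantumFieldTheory.Balaban1983to89.T4OutputRate
open Literature.MathematicalPhysics.QuantumFieldTheory.Balaban1983to89.T4ActivityLipschitz
open Literature.MathematicalPhysics.QuantumFieldTheory.Balaban1983to89.T4HistoryLipschitzRecursion
open Literature.MathematicalPhysics.QuantumFieldTheory.Balaban1983to89.T4HistoryLipschitzOuter
open Literature.MathematicalPhysics.QuantumFieldTheory.Balaban1983to89.T4HistoryLipschitzActivity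
open Literature.MathematicalPhysics.QuantumFieldTheory.Balaban1983to89.T4HistoryLipschitzSegment
open Literature.MathematicalPhysics.QuantumFieldTheory.Balaban1983to89.T4HistoryLipschitzActivity (ClusterGeom)
open Summit.QuantumFields.BalabanUV.T4Continuum.NE9EarleHamiltonChain Summit.QuantumFields.BalabanUV.T4Continuum.NE9FutureProfileStep
open Summit.QuantumFields.BalabanUV.T4Continuum.NE9FutureProfileEnd
open Summit.QuantumFields.BalabanUV.T4Continuum.NE9ChannelRealLinear
open Summit.QuantumFields.BalabanUV.T4Continuum.NE9SliceSpaceOfRecord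
open Summit.QuantumFields.BalabanUV.T4Continuum.NE9ChannelReadingOfRecord
open Summit.QuantumFields.BalabanUV.T4Continuum.NE9ChannelReadingSharp
open Summit.QuantumFields.BalabanUV.T4Continuum.NE9TableReading
open Summit.QuantumFields.BalabanUV.T4Continuum.NE9FutureProfileRecordPrelim
open Summit.QuantumFields.BalabanUV.T4Continuum.NE9FutureProfileEndOfRecordSharp
open Summit.QuantumFields.BalabanUV.T4Continuum.NE9FutureProfileEndOfRecordSP
open Summit.QuantumFields.BalabanUV.T4Continuum.NE9TwoPointKPOfPencil Summit.QuantumFields.BalabanUV.T4Continuum.NE9HoloSliceOfFamily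
open Summit.QuantumFields.BalabanUV.T4Continuum.NE9HoloFamilyOfPencil Summit.QuantumFields.BalabanUV.T4Continuum.NE9FutureProfileReal
open Summit.QuantumFields.BalabanUV.T4Continuum.NE9HoloFamilyVacuumSubtracted (psiOf_eq_vac)
open Literature.MathematicalPhysics.QuantumFieldTheory.Balaban1983to89.T4HistoryLipschitzWitness (norm_newTerm_le_of_potentialKPG)

variable {C : Carriers} (G : ClusterGeom C) {Bg : Type} {Pot : Type*} [NormedAddCommGroup Pot] [NormedSpace ℂ Pot]

/-! ## §1–§2 The cluster sum on the ball under KP for `m`: Kotecký–Preiss condition and holomorphy ((c-size) = the tree's `T4HistoryLipschitzWitness.norm_newTerm_le_of_potentialKPG`) -/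

omit [NormedSpace ℂ Pot] in
/-- [folklore] A majorant `m ≥ ‖w ·‖` on the step volume with the KP inequality for `m` (weights `a + d`, `d ≥ 0`) gives the
Kotecký–Preiss condition `IsKPVolume inc w a` on every sub-family of the volume — the tree's `isKPVolume_of_majorant` WITHOUT the
doubling `2m`, which its proof never used. [cite: KoteckyPreiss1986, (1) p.492] -/
theorem isKPVolume_of_majorant_kp1 {w : G.P → ℂ} {m : G.P → ℝ} {a d : G.P → ℝ} (hd : ∀ γ, 0 ≤ d γ) {X : C.Dom}
    (hw : ∀ γ ∈ G.vol X, ‖w γ‖ ≤ m γ)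
    (hkp1 : ∀ γ ∈ G.vol X, ∑ γ' ∈ G.vol X with G.inc γ' γ, m γ' * Real.exp (a γ' + d γ') ≤ a γ) {K : Finset G.P}
    (hK : K ⊆ G.vol X) : IsKPVolume G.inc w a K := by
  intro γ hγ
  refine le_trans ?_ (hkp1 γ (hK hγ))
  calc ∑ γ' ∈ K with G.inc γ' γ, kpTerm w a γ'
      ≤ ∑ γ' ∈ G.vol X with G.inc γ' γ, kpTerm w a γ' := by
        refine Finset.sum_le_sum_of_subset_of_nonneg (fun γ' hγ' => ?_) fun _ _ _ => kpTerm_nonneg _ _ _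
        rw [Finset.mem_filter] at hγ' ⊢
        exact ⟨hK hγ'.1, hγ'.2⟩
    _ ≤ ∑ γ' ∈ G.vol X with G.inc γ' γ, m γ' * Real.exp (a γ' + d γ') := by
        refine Finset.sum_le_sum fun γ' hγ' => ?_
        have hm : ‖w γ'‖ ≤ m γ' := hw γ' (Finset.mem_filter.mp hγ').1
        unfold kpTerm
        exact mul_le_mul hm (Real.exp_le_exp.mpr (le_add_of_nonneg_right (hd γ'))) (Real.exp_pos _).le
          ((norm_nonneg _).trans hm)

/-- **(c-holo) FOR THE NEW TERM UNDER KP FOR `m`** — every activity of the step volume line-holomorphic on `‖Q‖ < R₀` and dominated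
there by `m` with the KP inequality for `m` (weights `a + d`) ⇒ `Q ↦ newTerm act k s U X Q` is complex-differentiable on `ball 0 R₀`:
the tree's `NE9HoloFamilyOfPencil.differentiableOn_newTerm` with §1 in place of `isKPVolume_of_majorant` (KP for `2m`).  Under
Kotecký–Preiss all partition functions along the rays are zero-free, so the truncated functionals are holomorphic
(`differentiableOn_truncatedWeight_param_of_kp`). [cite: Balaban1988RG2Cluster, (2.13)-(2.15) pp.14-15; KoteckyPreiss1986, Theorem p.492] -/
theorem differentiableOn_newTerm_of_kp1 {act : ℕ → ℝ → Bg → Pot → G.P → ℂ} {m : G.P → ℝ} {a d : G.P → ℝ}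
    (hd : ∀ γ, 0 ≤ d γ) {k : ℕ} {s : ℝ} {U : Bg} {X : C.Dom} {R₀ : ℝ}
    (hhol : ∀ γ ∈ G.vol X, LineHolo (fun Q => act k s U Q γ) R₀)
    (hsup : ∀ Q ∈ ball (0 : Pot) R₀, ∀ γ ∈ G.vol X, ‖act k s U Q γ‖ ≤ m γ)
    (hkp1 : ∀ γ ∈ G.vol X, ∑ γ' ∈ G.vol X with G.inc γ' γ, m γ' * Real.exp (a γ' + d γ') ≤ a γ) :
    DifferentiableOn ℂ (fun Q => G.newTerm act k s U X Q) (ball (0 : Pot) R₀) := by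
  unfold ClusterGeom.newTerm clusterSum
  refine DifferentiableOn.fun_sum fun K hK => ?_
  refine differentiableOn_truncatedWeight_param_of_kp (v := fun Q γ => act k s U Q γ) K isOpen_ball
    (fun γ hγ => differentiableOn_act_of_lineHolo (hhol γ (G.clus_sub X K hK hγ))
      (fun Q hQ => hsup Q hQ γ (G.clus_sub X K hK hγ))) (a := a) fun Q hQ => ?_
  exact isKPVolume_of_majorant_kp1 G hd (fun γ hγ => hsup Q hQ γ hγ) hkp1 (G.clus_sub X K hK)

section Room

variable {ι : Type} [Nonempty ι] {E : Functional C Bg} {W : Set (ℕ → ℝ)} {Adm : Set (Bg → C.Dom → ℝ)}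
  {T : ℕ → (ℕ → ℝ) → (Bg → C.Dom → ℝ) → ι → ℝ} {Ψ : ℕ → ℝ → (ι → ℝ) → Bg → C.Dom → ℝ}
  {κ : ℝ} {wt : ℕ → ι → ℝ} {τ : ℕ → ℕ → ℝ} {τbar ω ωh : ℝ}

/-! ## §4 The three clauses of the vacuum-subtracted slice from `PotentialKPG`, on the whole ball -/

omit G [Nonempty ι] in
/-- [folklore] **(Φ-holo) ∕ (Φ-size) ∕ (Φ-real) FOR THE VACUUM-SUBTRACTED SLICE FROM `PotentialKPG`, ON `ball 0 R₀`** — for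
`holoSlice κ σ Φc`, `Φc k s Q U X := newTerm act k s U X Q − newTerm act k s U₀ X Q + explZ k U X`: (Φ-holo) by §2 twice, (Φ-size) with
budget `2B + p̄₀` by `norm_newTerm_le_of_potentialKPG` twice + the letter `hexplZ`∕`hp₀`, (Φ-real) EXACT from the record's shape `hΨv`; `σ` a conjugation fixing the
weighted readings of real tables. [cite: Balaban1987RG1, (2.13)-(2.14) p.268; Balaban1988RG2Cluster, (2.38) p.20 and (2.40)-(2.41) p.21] -/
theorem vacSlice_clauses_of_potentialKPG (G : ClusterGeom C) {σ : lp (fun _ : ι => ℂ) ∞ →L[ℝ] lp (fun _ : ι => ℂ) ∞}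
    (hσ : ∀ (c : ℂ) (x : lp (fun _ : ι => ℂ) ∞), σ (c • x) = conj c • σ x) (hiso : ∀ x, ‖σ x‖ = ‖x‖)
    (hfixρ : ∀ (k : ℕ) (P : ι → ℝ), σ (reading (wt k) P) = reading (wt k) P)
    {act : ℕ → ℝ → Bg → lp (fun _ : ι => ℂ) ∞ → G.P → ℂ} {m : ℕ → ℝ → Bg → G.P → ℝ} {a d : G.P → ℝ}
    {δ : C.Dom → ℝ} {U₀ : Bg} {explZ : ℕ → Bg → C.Dom → ℝ} {p₀ : ℕ → ℝ} {R₀ B pbar : ℝ}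
    (hB : 0 ≤ B) (hpbar : 0 ≤ pbar) (hKP : G.PotentialKPG W act m a d R₀)
    (hdec : G.DecayExtract δ d) (hpin : G.PinBudget a δ (fun _ => B) κ)
    (hΨv : ∀ (k : ℕ) (s : ℝ) (P : ι → ℝ) (U : Bg) (X : C.Dom),
      Ψ k s P U X = (G.newTerm act k s U X (reading (wt k) P)).re - (G.newTerm act k s U₀ X (reading (wt k) P)).re +
        explZ k U X)
    (hexplZ : ∀ (k : ℕ) (U : Bg) (X : C.Dom), C.scale X = k + 1 → |explZ k U X| ≤ Real.exp (-(κ * C.d X)) * p₀ k)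
    (hp₀ : ∀ k, p₀ k ≤ pbar) :
    (∀ k, ∀ g ∈ W, DifferentiableOn ℂ
      (holoSlice κ σ (fun k s Q U X => G.newTerm act k s U X Q - G.newTerm act k s U₀ X Q + ((explZ k U X : ℝ) : ℂ)) k (g k))
      (ball (0 : lp (fun _ : ι => ℂ) ∞) R₀)) ∧
    (∀ k, ∀ g ∈ W, MapsTo
      (holoSlice κ σ (fun k s Q U X => G.newTerm act k s U X Q - G.newTerm act k s U₀ X Q + ((explZ k U X : ℝ) : ℂ)) k (g k))
      (ball (0 : lp (fun _ : ι => ℂ) ∞) R₀) (closedBall 0 (2 * B + pbar))) ∧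
    (∀ k, ∀ g ∈ W, ∀ s ∈ W, reading (wt k) (T k s (E g)) ∈ ball (0 : lp (fun _ : ι => ℂ) ∞) R₀ →
      ∀ (U : Bg) (X : C.Dom),
        (holoSlice κ σ (fun k s Q U X => G.newTerm act k s U X Q - G.newTerm act k s U₀ X Q + ((explZ k U X : ℝ) : ℂ))
            k (s k) (reading (wt k) (T k s (E g))) : Bg × C.Dom → ℂ) (U, X) =
          ((Real.exp (κ * C.d X) * restrictScale (k + 1) (Ψ k (s k) (T k s (E g))) U X : ℝ) : ℂ)) := by
  set Φc : ℕ → ℝ → lp (fun _ : ι => ℂ) ∞ → Bg → C.Dom → ℂ := fun k s Q U X =>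
    G.newTerm act k s U X Q - G.newTerm act k s U₀ X Q + ((explZ k U X : ℝ) : ℂ) with hΦc
  have hB₁ : 0 ≤ 2 * B + pbar := by positivity
  have hd : ∀ γ, 0 ≤ d γ := hKP.2.1
  -- (c-holo): two Fréchet-holomorphic cluster sums (KP for m) and a constant
  have hcd : ∀ k, ∀ g ∈ W, ∀ (U : Bg) (X : C.Dom), C.scale X = k + 1 →
      DifferentiableOn ℂ (fun Q => Φc k (g k) Q U X) (ball 0 R₀) := by
    intro k g hg U X hX
    obtain ⟨hhU, hmU, hkU⟩ := hKP.2.2 g hg k U X hX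
    obtain ⟨hh0, hm0, hk0⟩ := hKP.2.2 g hg k U₀ X hX
    exact ((differentiableOn_newTerm_of_kp1 G hd hhU hmU hkU).sub
      (differentiableOn_newTerm_of_kp1 G hd hh0 hm0 hk0)).add (differentiableOn_const _)
  -- (c-size): pin budget twice + the explicit part's letter, on the OPEN ball
  have hcb : ∀ k, ∀ g ∈ W, ∀ (U : Bg) (X : C.Dom), C.scale X = k + 1 →
      ∀ Q ∈ ball (0 : lp (fun _ : ι => ℂ) ∞) R₀, ‖Φc k (g k) Q U X‖ ≤ Real.exp (-(κ * C.d X)) * (2 * B + pbar) := by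
    intro k g hg U X hX Q hQ
    have h1 := norm_newTerm_le_of_potentialKPG G hKP hdec hpin hg (U := U) hX hQ
    have h2 := norm_newTerm_le_of_potentialKPG G hKP hdec hpin hg (U := U₀) hX hQ
    have h3 := (hexplZ k U X hX).trans (mul_le_mul_of_nonneg_left (hp₀ k) (Real.exp_pos _).le)
    calc ‖Φc k (g k) Q U X‖
        ≤ ‖G.newTerm act k (g k) U X Q‖ + ‖G.newTerm act k (g k) U₀ X Q‖ + ‖((explZ k U X : ℝ) : ℂ)‖ :=
          (norm_add_le _ _).trans (add_le_add (norm_sub_le _ _) le_rfl)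
      _ ≤ B * Real.exp (-(κ * C.d X)) + B * Real.exp (-(κ * C.d X)) + Real.exp (-(κ * C.d X)) * pbar := by
          refine add_le_add (add_le_add h1 h2) ?_
          rw [Complex.norm_real, Real.norm_eq_abs]
          exact h3
      _ = Real.exp (-(κ * C.d X)) * (2 * B + pbar) := by ring
  -- (c-real): EXACT
  have hcre : ∀ k, ∀ g ∈ W, ∀ s ∈ W, ∀ (U : Bg) (X : C.Dom), C.scale X = k + 1 →
      Ψ k (s k) (T k s (E g)) U X = (Φc k (s k) (reading (wt k) (T k s (E g))) U X).re := by
    intro k g _ s _ U X _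
    rw [hΨv]
    simp only [hΦc, Complex.add_re, Complex.sub_re, Complex.ofReal_re]
  exact ⟨fun k g hg => holoSlice_differentiableOn hσ hiso hB₁ (hcd k g hg) (hcb k g hg),
    fun k g hg => holoSlice_mapsTo hσ hiso hB₁ (hcd k g hg) (hcb k g hg),
    holoSlice_real hσ hiso hfixρ hB₁ hcd hcb hcre⟩

/-! ## §5 THE ♯-END OF RECORD ON `PotentialKPG` LETTERS, room on `R₀` (no inner radius) -/

omit G in
/-- **ROUTE R4♯'s END OF RECORD ON THE RECORD's NEW-TERM SHAPE, TABLE HALF IN `PotentialKPG` LETTERS (KP for `m`), NO INNER RADIUS.**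
Hypotheses: the END of record's structural binders (`h0`, `AdmissibleTerms`, `AdmRestrict`, `ChannelAdditive`, `ChannelLocal`,
`ChannelSizeAtStepNN` + `hτ`, `Factorises`, `LastCouplingLipschitz` + `hlam`, `hsmul`, `hne`, `hwt`, `hω`∕`hωh`∕`hωωh`); the PENCIL as
`hKP : PotentialKPG W act m a d R₀` (line-holomorphy + majorant + KP for `m` on `‖Q‖ < R₀`, at every background incl. `U₀` — the letter
of the R3′ ENDs p256040∕p256132∕p256991), `hdec`, `hpin` (budget `B`); the record's SHAPE `hΨv` and `hexplZ`∕`hp₀`; and the ROOM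
`ω̂·R₀ + τ̄·(2B + p̄₀) ≤ θ·R₀`, `0 < R₀`, `0 < θ < 1`.  NO `hkp2` (KP for 2m), NO `s₀`.  Conclusion: `NE9 E W κ (prodModuli ((1∕(1−θ²))·ℓ)
(fun _ => θ)) ∧ FadingMemory ((1∕(1−θ²))·ℓ∕θ) θ (…)`.  Proof: §4 (σ := Mathlib's `star`) into leaf-05's
`ne9_and_fadingMemory_of_holoSlice_sharp_SP` at `r := R₀`.  «NE9 ⇐ the named binders».
[cite: Balaban1987RG1, (2.13)-(2.14) p.268; Balaban1988RG2Cluster, (2.14)-(2.15) p.15, (2.38) p.20, (2.40)-(2.41) p.21, (1.36) p.9; FV1980, ch.V §5] -/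
theorem ne9_and_fadingMemory_of_potentialKPG_SP_vac (G : ClusterGeom C)
    (h0 : ∀ g ∈ W, ∀ (U : Bg) (X : C.Dom), C.scale X = 0 → E g U X = 0)
    (hAdm : AdmissibleTerms E W Adm) (hres : AdmRestrict Adm) (hadd : ChannelAdditive Adm T) (hloc : ChannelLocal Adm T)
    (hstep : ChannelSizeAtStepNN Adm T κ wt τ) (hfac : Factorises E W T Ψ) {lam : ℕ → ℝ}
    (hlast : LastCouplingLipschitz E W T Ψ κ lam)
    (hsmul : ∀ (c : ℝ), ∀ H ∈ Adm, c • H ∈ Adm) (hne : Adm.Nonempty) (hwt : ∀ m y, 0 < wt m y)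
    (hτ : ∀ k j, j ≤ k → 0 ≤ τ k j ∧ τ k j ≤ τbar * ω ^ (k - j)) (hτbar : 0 < τbar) (hω : 0 ≤ ω) (hωh : 0 < ωh)
    (hωωh : ω ≤ ωh)
    {act : ℕ → ℝ → Bg → lp (fun _ : ι => ℂ) ∞ → G.P → ℂ} {m : ℕ → ℝ → Bg → G.P → ℝ} {a d : G.P → ℝ}
    {δ : C.Dom → ℝ} {U₀ : Bg} {explZ : ℕ → Bg → C.Dom → ℝ} {p₀ : ℕ → ℝ} {R₀ B pbar θ ℓ : ℝ}
    (hR₀ : 0 < R₀) (hB : 0 ≤ B) (hpbar : 0 ≤ pbar) (hθ0 : 0 < θ) (hθ1 : θ < 1) (hℓ : 0 ≤ ℓ)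
    (hKP : G.PotentialKPG W act m a d R₀) (hdec : G.DecayExtract δ d) (hpin : G.PinBudget a δ (fun _ => B) κ)
    (hΨv : ∀ (k : ℕ) (s : ℝ) (P : ι → ℝ) (U : Bg) (X : C.Dom),
      Ψ k s P U X = (G.newTerm act k s U X (reading (wt k) P)).re - (G.newTerm act k s U₀ X (reading (wt k) P)).re +
        explZ k U X)
    (hexplZ : ∀ (k : ℕ) (U : Bg) (X : C.Dom), C.scale X = k + 1 → |explZ k U X| ≤ Real.exp (-(κ * C.d X)) * p₀ k)
    (hp₀ : ∀ k, p₀ k ≤ pbar)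
    (hroom : ωh * R₀ + τbar * (2 * B + pbar) ≤ θ * R₀) (hlam : ∀ k, lam k ≤ ℓ) :
    NE9 E W κ (prodModuli (1 / (1 - θ ^ 2) * ℓ) fun _ => θ) ∧
      FadingMemory (1 / (1 - θ ^ 2) * ℓ / θ) θ (prodModuli (1 / (1 - θ ^ 2) * ℓ) fun _ => θ) := by
  obtain ⟨σ, hσa, hσ, hiso⟩ := exists_star_clm_lp (ι := ι)
  have hfixρ : ∀ (k : ℕ) (P : ι → ℝ), σ (reading (wt k) P) = reading (wt k) P := fun k P => by
    rw [hσa]; exact (isSelfAdjoint_reading (wt k) P).star_eq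
  obtain ⟨hΦd, hΦb, hreal⟩ := vacSlice_clauses_of_potentialKPG (W := W) (E := E) (T := T) (Ψ := Ψ) (κ := κ) G hσ
    hiso hfixρ hB hpbar hKP hdec hpin hΨv hexplZ hp₀
  exact ne9_and_fadingMemory_of_holoSlice_sharp_SP h0 hAdm hres hadd hloc hstep hfac hlast hsmul hne hwt hτ hτbar hω hωh hωωh
    hR₀ (by positivity) hθ0 hθ1 hℓ hΦd hΦb hreal hroom hlam

/-! ## §6 By-product: the term-size bound from the same letters (no size induction) -/

omit G in
/-- **TERM SIZE ON ROUTE R4 FROM `PotentialKPG` + ROOM** — the same data as §5 MINUS `hlast`∕`hlam`∕`hθ0` give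
`TermSize E W κ (fun _ => 2B + p̄₀)`: every term of every history of the window is `≤ (2B + p̄₀)·e^{−κd(X)}` — END #1's first
conjunct with the uniform profile, WITHOUT the size-induction data (`hbase`∕`hNsucc`∕`hNnn`∕`hbox`); by
`NE9FutureProfileEndOfRecordSharp.orbit_of_record_injRead` (i) on §4's slice. [cite: Balaban1987RG1, (1.18) p.263 and (2.13) p.268] -/
theorem termSize_of_potentialKPG_room (G : ClusterGeom C)
    (h0 : ∀ g ∈ W, ∀ (U : Bg) (X : C.Dom), C.scale X = 0 → E g U X = 0)
    (hAdm : AdmissibleTerms E W Adm) (hres : AdmRestrict Adm) (hadd : ChannelAdditive Adm T) (hloc : ChannelLocal Adm T)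
    (hstep : ChannelSizeAtStepNN Adm T κ wt τ) (hfac : Factorises E W T Ψ)
    (hsmul : ∀ (c : ℝ), ∀ H ∈ Adm, c • H ∈ Adm) (hne : Adm.Nonempty) (hwt : ∀ m y, 0 < wt m y)
    (hτ : ∀ k j, j ≤ k → 0 ≤ τ k j ∧ τ k j ≤ τbar * ω ^ (k - j)) (hτbar : 0 < τbar) (hω : 0 ≤ ω) (hωh : 0 < ωh)
    (hωωh : ω ≤ ωh)
    {act : ℕ → ℝ → Bg → lp (fun _ : ι => ℂ) ∞ → G.P → ℂ} {m : ℕ → ℝ → Bg → G.P → ℝ} {a d : G.P → ℝ}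
    {δ : C.Dom → ℝ} {U₀ : Bg} {explZ : ℕ → Bg → C.Dom → ℝ} {p₀ : ℕ → ℝ} {R₀ B pbar θ : ℝ}
    (hR₀ : 0 < R₀) (hB : 0 ≤ B) (hpbar : 0 ≤ pbar) (hθ1 : θ < 1)
    (hKP : G.PotentialKPG W act m a d R₀) (hdec : G.DecayExtract δ d) (hpin : G.PinBudget a δ (fun _ => B) κ)
    (hΨv : ∀ (k : ℕ) (s : ℝ) (P : ι → ℝ) (U : Bg) (X : C.Dom),
      Ψ k s P U X = (G.newTerm act k s U X (reading (wt k) P)).re - (G.newTerm act k s U₀ X (reading (wt k) P)).re +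
        explZ k U X)
    (hexplZ : ∀ (k : ℕ) (U : Bg) (X : C.Dom), C.scale X = k + 1 → |explZ k U X| ≤ Real.exp (-(κ * C.d X)) * p₀ k)
    (hp₀ : ∀ k, p₀ k ≤ pbar) (hroom : ωh * R₀ + τbar * (2 * B + pbar) ≤ θ * R₀) :
    TermSize E W κ (fun _ => 2 * B + pbar) := by
  obtain ⟨σ, hσa, hσ, hiso⟩ := exists_star_clm_lp (ι := ι)
  have hfixρ : ∀ (k : ℕ) (P : ι → ℝ), σ (reading (wt k) P) = reading (wt k) P := fun k P => by
    rw [hσa]; exact (isSelfAdjoint_reading (wt k) P).star_eq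
  obtain ⟨-, hΦb, hreal⟩ := vacSlice_clauses_of_potentialKPG (W := W) (E := E) (T := T) (Ψ := Ψ) (κ := κ) G hσ
    hiso hfixρ hB hpbar hKP hdec hpin hΨv hexplZ hp₀
  intro g hg U X
  exact (orbit_of_record_injRead h0 hAdm hres hadd hloc hstep hfac hsmul hne hwt hτ hω hωh hωωh hτbar.le
    (fun j n s _ => norm_RdAmb_le_geometric_sharp (τ_geom hτ) j n s) hR₀ (by positivity) hθ1 hΦb hreal hroom hg
    (C.scale X)).1 U X le_rfl

end Room

/-! ## §7 At the record's own new-term map `NE9EndApplied.ΨOf` (shape by `rfl`) -/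

section Record

open Summit.QuantumFields.BalabanUV.T4Continuum.NE9EndApplied
open Summit.QuantumFields.BalabanUV.T4Continuum.NE9ComplexEncoding (doubleCarriers)

variable {C₀ : Carriers} {E : Type} {ι : Type}

omit G in
/-- **ROUTE R4♯'s END AT THE RECORD's OWN NEW-TERM MAP `ΨOf`, TABLE HALF IN `PotentialKPG` LETTERS, NO INNER RADIUS** — §5 at
`Ψ := NE9EndApplied.ΨOf G act wt U₀ explZ` (`hΨv` by `NE9HoloFamilyVacuumSubtracted.psiOf_eq_vac`, `rfl`): for ANY functional `Ef` on the
re∕im-doubled carriers factorising through a channel `T` with this new-term map (e.g. `EfOf …`, `NE9EndApplied.factorises_EfOf`),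
`PotentialKPG` on `R₀` + `hdec` + `hpin` + `hexplZ`∕`hp₀` + structural binders + `hlast` + ROOM `ω̂·R₀ + τ̄·(2B + p̄₀) ≤ θ·R₀` ⇒
`NE9 Ef W κ (prodModuli ((1∕(1−θ²))·ℓ) (fun _ => θ)) ∧ FadingMemory …`.  Compare the R3′ END at the record
`NE9PencilEndSharpVacuum.ne9_and_fadingMemory_of_potentialKPG_psiOf` (p256132): the SAME `hKP`∕`hdec`∕`hpin`∕structural∕`hlast`
letters PLUS `hsR : s₀ < R₀`, `hρ`, `hocc` (tables in `closedBall 0 s₀`), rate `ω + 2Bτ̄∕(R₀ − s₀)`.  «NE9 ⇐ the named binders».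
[cite: Balaban1987RG1, (2.13)-(2.14) p.268 and (0.23) p.256; Balaban1988RG2Cluster, (2.14)-(2.15) p.15, (2.38) p.20, (2.40)-(2.41) p.21; FV1980, ch.V §5] -/
theorem ne9_and_fadingMemory_of_potentialKPG_psiOf_SP [Nonempty ι] (G : ClusterGeom (doubleCarriers C₀))
    {Ef : Functional (doubleCarriers C₀) E} {W : Set (ℕ → ℝ)} {Adm : Set (E → (doubleCarriers C₀).Dom → ℝ)}
    {T : ℕ → (ℕ → ℝ) → (E → (doubleCarriers C₀).Dom → ℝ) → ι → ℝ} {κ : ℝ} {wt : ℕ → ι → ℝ} {τ : ℕ → ℕ → ℝ}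
    {τbar ω ωh : ℝ} {act : ℕ → ℝ → E → lp (fun _ : ι => ℂ) ∞ → G.P → ℂ} {U₀ : E}
    {explZ : ℕ → E → (doubleCarriers C₀).Dom → ℝ}
    (h0 : ∀ g ∈ W, ∀ (U : E) (X : (doubleCarriers C₀).Dom), (doubleCarriers C₀).scale X = 0 → Ef g U X = 0)
    (hAdm : AdmissibleTerms Ef W Adm) (hres : AdmRestrict Adm) (hadd : ChannelAdditive Adm T) (hloc : ChannelLocal Adm T)
    (hstep : ChannelSizeAtStepNN Adm T κ wt τ) (hfac : Factorises Ef W T (ΨOf G act wt U₀ explZ)) {lam : ℕ → ℝ}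
    (hlast : LastCouplingLipschitz Ef W T (ΨOf G act wt U₀ explZ) κ lam)
    (hsmul : ∀ (c : ℝ), ∀ H ∈ Adm, c • H ∈ Adm) (hne : Adm.Nonempty) (hwt : ∀ m y, 0 < wt m y)
    (hτ : ∀ k j, j ≤ k → 0 ≤ τ k j ∧ τ k j ≤ τbar * ω ^ (k - j)) (hτbar : 0 < τbar) (hω : 0 ≤ ω) (hωh : 0 < ωh)
    (hωωh : ω ≤ ωh) {m : ℕ → ℝ → E → G.P → ℝ} {a d : G.P → ℝ} {δ : (doubleCarriers C₀).Dom → ℝ} {p₀ : ℕ → ℝ}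
    {R₀ B pbar θ ℓ : ℝ} (hR₀ : 0 < R₀) (hB : 0 ≤ B) (hpbar : 0 ≤ pbar) (hθ0 : 0 < θ) (hθ1 : θ < 1) (hℓ : 0 ≤ ℓ)
    (hKP : G.PotentialKPG W act m a d R₀) (hdec : G.DecayExtract δ d) (hpin : G.PinBudget a δ (fun _ => B) κ)
    (hexplZ : ∀ (k : ℕ) (U : E) (X : (doubleCarriers C₀).Dom), (doubleCarriers C₀).scale X = k + 1 →
      |explZ k U X| ≤ Real.exp (-(κ * (doubleCarriers C₀).d X)) * p₀ k)
    (hp₀ : ∀ k, p₀ k ≤ pbar)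
    (hroom : ωh * R₀ + τbar * (2 * B + pbar) ≤ θ * R₀) (hlam : ∀ k, lam k ≤ ℓ) :
    NE9 Ef W κ (prodModuli (1 / (1 - θ ^ 2) * ℓ) fun _ => θ) ∧
      FadingMemory (1 / (1 - θ ^ 2) * ℓ / θ) θ (prodModuli (1 / (1 - θ ^ 2) * ℓ) fun _ => θ) :=
  ne9_and_fadingMemory_of_potentialKPG_SP_vac G h0 hAdm hres hadd hloc hstep hfac hlast hsmul hne hwt hτ hτbar hω hωh hωωh
    hR₀ hB hpbar hθ0 hθ1 hℓ hKP hdec hpin (fun k s Q U X => psiOf_eq_vac G act wt U₀ explZ k s Q U X) hexplZ hp₀ hroom hlam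

end Record

end Summit.QuantumFields.BalabanUV.T4Continuum.NE9HoloFamilyPotentialKPG

end
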